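import Summits.BirchSwinnertonDyer.BirchSwinnertonDyer.Theorems.UniversalToricDescentPrincipalHeegnerIndivisibleDefs
import Summits.BirchSwinnertonDyer.BirchSwinnertonDyer.Theorems.UniversalToricDescentTwinGoodSSDefs
import HarnessLib
import HarnessLib.Audit.Tags

/-!
# Route `UniversalToricDescent` — light defs module for line `beta-road` v19 on crux r205 stmt-BirchSwinnertonDyer-24737
# `TwinAlgMuZeroAtThree`: the two research stubs K1‴ and C₀′ WITH THE CRUX'S MODULAR-PARAMETRISATION BINDER `Dt′` THREADED

Cell `pub/bsd-wall`, LEAD lineage `bsd-wall-utd-p1` (g34), 2026-08-30; `--supports stmt-BirchSwinnertonDyer-24737 --as helper`.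
Companion of `UniversalToricDescentPrincipalHeegnerIndivisibleDefs` (K1″, p771182) and `UniversalToricDescentTwinGoodSSDefs` (C₀, p774065).

WHY (LEAD g34 definitional audit of the registered stub texts of skeleton v18, sha16 `36c96564301e5a48`).  The crux `TwinAlgMuZeroAtThree`
(R2 text) carries the binder `(Dt' : ModularParametrizationData W' N')` — the modular parametrisation of the twin, i.e. the Modularity
theorem + uniformisation + an integral Manin constant AS DATA (`Literature.….ModularForms.nonempty_modularParametrizationData`, BCDT 2001
Thm. A, a NAMED FACT of the tree, `↔ exists_isNewformOf`).  Two of the three registered stubs of v18 DROP that binder although their proofs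
need it: K1″ `PrincipalHeegnerIndivisibleMultAtThree` concludes `∃ (jbar) (Dt : ModularParametrizationData W' N') …` from the bucket-B
arithmetic binders alone, so ANY proof of K1″ must CONSTRUCT a parametrisation datum, i.e. invoke the named fact — `K1″ ⟹ Modularity-as-data
for every bucket-B twin`; and C₀ `TwinAlgMuZeroAtThreeGoodSS` (the good-supersingular bucket of R2 «VERBATIM») is in fact R2's bucket MINUS
the binder `Dt'`, so any signed-frame proof of it (which starts from the newform `Dt'.f`) must again invoke the named fact.  Consequently
`K1″_holds` / `C₀_holds` could only ever be CONDITIONAL results and line `beta-road` could never close 24737 outright, while the crux's own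
`Dt'` is introduced and discarded by the landed composition (`…TwinAlgMuZeroAtThreeOfBetaRoad.twinAlgMuZeroAtThree_of_betaRoadStubs`,
`intro … Dt' …`, unused; vet flag `ground.unused-binder Dt'` on 24737).  THIS MODULE states the repaired stubs — each is the v18 text with
the crux's binder `(Dt' : ModularParametrizationData W' N')` inserted at the crux's position (after `[NumberField K]`), NOTHING ELSE changed:
* `PrincipalHeegnerIndivisibleMultOfParamAtThree` (K1‴) — implied by K1″ (ignore `Dt'`), so the reshape WEAKENS the stub; the `∃ Dt` of
  the conclusion stays free (a `∀ Dt`-indivisibility is false: `(f, L, 3c, 9·deg)` is again a datum and has Heegner points `3·y`);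
* `TwinAlgMuZeroAtThreeGoodSSOfParam` (C₀′) — implied by C₀; = the good-supersingular `a₃ = 0` bucket of the R2 text now binder-for-binder.
Both `@[conjecture] def … : Prop` (OPEN statements in our theories — obligation nodes provable / refutable BY NAME, never Literature facts;
K1‴ instrument-decidable per instance) with `Iff.rfl` readbacks.  The implications K1″ → K1‴, C₀ → C₀′ and the `Dt'`-threaded composition
«K1‴ → K2a‴ → C₀′ → crux BY NAME» are THEOREMS of the companion module `UniversalToricDescentTwinAlgMuZeroAtThreeOfBetaRoadParam`.
ROUTE-INDEPENDENT (no `Theses` import); no instance, no notation, no theorem content, no `sorry`.  Declaring the constants proves nothing: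
crux 24737 stays OPEN and BSD is proved for no curve by this file.

References: [Castella2024] §2.2, Thm. 2.1 (the points `y_{p^m}` at `p ∥ N`; shape); [BertoliniDarmon1996] §2.5; [GrossLMS1991] §3;
[BurungaleCastellaSkinner2025] Thm. 4.2.1 (b), Prop. 4.2.2 (shape of algebraic `μ = 0`, p ∤ N there); [BCDTJAMS2001] Thm. A (what `Dt'` carries).
-/

noncomputable section

open scoped Classical NumberField

set_option linter.dupNamespace false -- `…BirchSwinnertonDyer.BirchSwinnertonDyer…` is the cell's nested layout (D-0017)
set_option autoImplicit false

namespace Summit.BirchSwinnertonDyer.BirchSwinnertonDyer.Theorems.UniversalToricDescentBetaRoadParamDefs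

open NumberField IsDedekindDomain Field WeierstrassCurve Finset
open Literature.NumberTheory.EllipticCurves Literature.NumberTheory.EllipticCurves.IwasawaAlgebra
open Literature.NumberTheory.EllipticCurves.ZpExtension Literature.NumberTheory.EllipticCurves.GreenbergSelmer
open Summit.BirchSwinnertonDyer.Rank1Residual.X11b Summit.BirchSwinnertonDyer.Rank1Residual.X11b.AcSelmer
open Literature.NumberTheory.EllipticCurves.ModularForms (ModularParametrizationData heegnerPointComplexOfConductor)

/-- **`PrincipalHeegnerIndivisibleMultOfParamAtThree`** (K1‴ of line `beta-road` v19 on crux 24737 = K1″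
`UniversalToricDescentPrincipalHeegnerIndivisibleDefs.PrincipalHeegnerIndivisibleMultAtThree` WITH the crux's modular-parametrisation binder
`(Dt' : ModularParametrizationData W' N')` inserted after `[NumberField K]`, nothing else changed).  For every bucket-B twin `W′/ℚ`
(multiplicative at `3` with `3 ∤ v₃(Δ′)`, `ρ̄₃` onto, conductor `N′`) GIVEN a modular parametrisation datum `Dt′` at level `N′`, every
imaginary quadratic `K` Heegner for `N′` with odd discriminant, every anticyclotomic `ℤ₃`-extension `κ` and every degree-one prime `𝔭 ∋ 3`
of `K`: there are `jbar`, `Dt`, `β` (`4N′ ∣ β² − d_K`), `k`, a point `x ∈ E′(K̄)` with `complexPoint W′ jbar x =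
heegnerPointComplexOfConductor Dt d_K β 3^{k+1}` and a transversal `R ⊆ Γ_{K_k}` of `Gal(K̄/K[3^{k+1}])` such that `3 • P ≠ ∑_{r ∈ R} r • x`
for every `P` fixed by `Γ_{K_k} ⊓ D_𝔭`.  RESEARCH (decidable per instance, unknown class-wide); weaker than K1″ (which must produce `Dt`
from the arithmetic binders alone, i.e. through the Modularity named fact); a definition only, nothing is proved by it.
[cite: Castella2024, §2.2 and Thm. 2.1 (shape of the points y_{p^m} at p ∥ N; nothing asserted)] [cite: BertoliniDarmon1996, §2.5 (shape; nothing asserted)] [cite: GrossLMS1991, §3 (Heegner points of conductor c; shape)] -/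
@[conjecture]
def PrincipalHeegnerIndivisibleMultOfParamAtThree : Prop :=
    ∀ (W' : WeierstrassCurve ℚ) [W'.IsElliptic] [W'.IsGloballyMinimal] (N' : ℕ) [NeZero N']
      (K : Type) [Field K] [NumberField K] (_Dt' : ModularParametrizationData W' N'),
      Rank1Residual.Mult W' 3 → ¬ 3 ∣ padicValInt 3 W'.minimalDiscriminantInt →
      W'.HasSurjectiveModNGaloisRep 3 → W'.conductorNorm ℤ = N' → IsImaginaryQuadratic K →
      SatisfiesHeegnerHypothesis N' K → Odd (NumberField.discr K) →
      ∀ (κ : ZpExtension K 3), κ.IsAnticyclotomic →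
      ∀ (𝔭 : HeightOneSpectrum (𝓞 K)), ((3 : ℕ) : 𝓞 K) ∈ 𝔭.asIdeal →
        𝔭.asIdeal.ramificationIdx (𝓞 ℚ) = 1 → 𝔭.asIdeal.inertiaDeg (𝓞 ℚ) = 1 →
      ∃ (jbar : AlgebraicClosure K →+* ℂ) (Dt : ModularParametrizationData W' N') (β : ℤ)
        (_ : (4 * N' : ℤ) ∣ β ^ 2 - NumberField.discr K) (k : ℕ)
        (x : geomPoints (W'.baseChange K)) (R : Finset (absoluteGaloisGroup K)),
        complexPoint W' jbar x = heegnerPointComplexOfConductor Dt (NumberField.discr K) β (3 ^ (k + 1)) ∧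
        (↑R ⊆ (κ.layerSubgroup k : Set (absoluteGaloisGroup K))) ∧
        (∀ τ ∈ κ.layerSubgroup k, ∃! r, r ∈ R ∧ r⁻¹ * τ ∈ ringClassSubgroup K (3 ^ (k + 1)) jbar) ∧
        ∀ (P : geomPoints (W'.baseChange K)), (∀ σ ∈ κ.layerSubgroup k ⊓ decomp 𝔭, σ • P = P) →
          (3 : ℤ) • P ≠ ∑ r ∈ R, r • x

/-- **Readback** (`Iff.rfl`): `PrincipalHeegnerIndivisibleMultOfParamAtThree` unfolds to the registered `stub_principalHeegnerIndivisibleMult`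
text of skeleton v19 literally (= the v16/v18 K1″ text with the binder `(_Dt' : ModularParametrizationData W' N')` inserted).
[cite: Castella2024, §2.2 (shape; nothing asserted)] -/
theorem principalHeegnerIndivisibleMultOfParamAtThree_iff :
    PrincipalHeegnerIndivisibleMultOfParamAtThree ↔
    ∀ (W' : WeierstrassCurve ℚ) [W'.IsElliptic] [W'.IsGloballyMinimal] (N' : ℕ) [NeZero N']
      (K : Type) [Field K] [NumberField K] (_Dt' : ModularParametrizationData W' N'),
      Rank1Residual.Mult W' 3 → ¬ 3 ∣ padicValInt 3 W'.minimalDiscriminantInt →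
      W'.HasSurjectiveModNGaloisRep 3 → W'.conductorNorm ℤ = N' → IsImaginaryQuadratic K →
      SatisfiesHeegnerHypothesis N' K → Odd (NumberField.discr K) →
      ∀ (κ : ZpExtension K 3), κ.IsAnticyclotomic →
      ∀ (𝔭 : HeightOneSpectrum (𝓞 K)), ((3 : ℕ) : 𝓞 K) ∈ 𝔭.asIdeal →
        𝔭.asIdeal.ramificationIdx (𝓞 ℚ) = 1 → 𝔭.asIdeal.inertiaDeg (𝓞 ℚ) = 1 →
      ∃ (jbar : AlgebraicClosure K →+* ℂ) (Dt : ModularParametrizationData W' N') (β : ℤ)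
        (_ : (4 * N' : ℤ) ∣ β ^ 2 - NumberField.discr K) (k : ℕ)
        (x : geomPoints (W'.baseChange K)) (R : Finset (absoluteGaloisGroup K)),
        complexPoint W' jbar x = heegnerPointComplexOfConductor Dt (NumberField.discr K) β (3 ^ (k + 1)) ∧
        (↑R ⊆ (κ.layerSubgroup k : Set (absoluteGaloisGroup K))) ∧
        (∀ τ ∈ κ.layerSubgroup k, ∃! r, r ∈ R ∧ r⁻¹ * τ ∈ ringClassSubgroup K (3 ^ (k + 1)) jbar) ∧
        ∀ (P : geomPoints (W'.baseChange K)), (∀ σ ∈ κ.layerSubgroup k ⊓ decomp 𝔭, σ • P = P) →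
          (3 : ℤ) • P ≠ ∑ r ∈ R, r • x :=
  Iff.rfl

/-- **`TwinAlgMuZeroAtThreeGoodSSOfParam`** (C₀′ of line `beta-road` v19 on crux 24737 = C₀ `UniversalToricDescentTwinGoodSSDefs.TwinAlgMuZeroAtThreeGoodSS`
WITH the crux's modular-parametrisation binder `(Dt' : ModularParametrizationData W' N')` inserted after `[NumberField K]`, nothing else changed
— i.e. the good-supersingular `a₃ = 0` bucket of the R2 text of `TwinAlgMuZeroAtThree` binder-for-binder): for `W′/ℚ` good supersingular at `3`
with `a₃ = 0`, `ρ̄₃` onto, conductor `N′`, GIVEN a modular parametrisation datum `Dt′` at level `N′`, `K` imaginary quadratic Heegner for `N′` with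
odd `d_K`, `κ` anticyclotomic with topological generator `γ`, `𝔭 ∋ 3` of degree one and `𝔭′ ∋ 3`, `𝔭′ ≠ 𝔭`: `X_(∅,0)(E′/K_∞)` at `𝔭′` is
`Λ`-torsion and its characteristic ideal in `R₀⟦T⟧` has a generator with a coefficient of `3`-adic norm `1`.  RESEARCH (signed frame); weaker
than C₀; a definition only, nothing is proved by it.
[cite: BurungaleCastellaSkinner2025, Thm. 4.2.1 (b) and Prop. 4.2.2 (shape only, p ∤ N there; nothing asserted)] [cite: Howard2004HeegnerKolyvagin, Thm. B (shape only)] -/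
@[conjecture]
def TwinAlgMuZeroAtThreeGoodSSOfParam : Prop :=
    ∀ (W' : WeierstrassCurve ℚ) [W'.IsElliptic] [W'.IsGloballyMinimal] (N' : ℕ) [NeZero N']
      (K : Type) [Field K] [NumberField K] (_Dt' : ModularParametrizationData W' N'),
      Rank1Residual.GoodSS W' 3 → W'.frobeniusTrace 3 = 0 →
      W'.HasSurjectiveModNGaloisRep 3 → W'.conductorNorm ℤ = N' → IsImaginaryQuadratic K →
      SatisfiesHeegnerHypothesis N' K → Odd (NumberField.discr K) →
      ∀ (κ : ZpExtension K 3), κ.IsAnticyclotomic →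
      ∀ (γ : absoluteGaloisGroup K) [Fact (κ.IsTopGenerator γ)]
        (𝔭 : HeightOneSpectrum (𝓞 K)), ((3 : ℕ) : 𝓞 K) ∈ 𝔭.asIdeal →
        𝔭.asIdeal.ramificationIdx (𝓞 ℚ) = 1 → 𝔭.asIdeal.inertiaDeg (𝓞 ℚ) = 1 →
      ∀ (𝔭' : HeightOneSpectrum (𝓞 K)), ((3 : ℕ) : 𝓞 K) ∈ 𝔭'.asIdeal → 𝔭' ≠ 𝔭 →
      Module.IsTorsion (IwasawaAlgebra 3) (XAc (W'.baseChange K) 3 κ 𝔭' ∅ γ) ∧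
        ∃ g' : UnrSeries 3,
          (XAc.charIdeal (W'.baseChange K) 3 κ 𝔭' ∅ γ).map (PowerSeries.map (Halves.toUnr 3)) =
              Ideal.span {g'} ∧
            ∃ i : ℕ, ‖((PowerSeries.coeff i g' : unrIntegers 3) : ℂ_[3])‖ = 1

/-- **Readback** (`Iff.rfl`): `TwinAlgMuZeroAtThreeGoodSSOfParam` unfolds to the registered `stub_goodSS` text of skeleton v19 literally
(= the v1–v18 C₀ text with the binder `(_Dt' : ModularParametrizationData W' N')` inserted = the `a₃ = 0` good-supersingular bucket of the R2 text
of crux 24737 binder-for-binder). [cite: Howard2004HeegnerKolyvagin, Thm. B (shape only)] -/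
theorem twinAlgMuZeroAtThreeGoodSSOfParam_iff :
    TwinAlgMuZeroAtThreeGoodSSOfParam ↔
    ∀ (W' : WeierstrassCurve ℚ) [W'.IsElliptic] [W'.IsGloballyMinimal] (N' : ℕ) [NeZero N']
      (K : Type) [Field K] [NumberField K] (_Dt' : ModularParametrizationData W' N'),
      Rank1Residual.GoodSS W' 3 → W'.frobeniusTrace 3 = 0 →
      W'.HasSurjectiveModNGaloisRep 3 → W'.conductorNorm ℤ = N' → IsImaginaryQuadratic K →
      SatisfiesHeegnerHypothesis N' K → Odd (NumberField.discr K) →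
      ∀ (κ : ZpExtension K 3), κ.IsAnticyclotomic →
      ∀ (γ : absoluteGaloisGroup K) [Fact (κ.IsTopGenerator γ)]
        (𝔭 : HeightOneSpectrum (𝓞 K)), ((3 : ℕ) : 𝓞 K) ∈ 𝔭.asIdeal →
        𝔭.asIdeal.ramificationIdx (𝓞 ℚ) = 1 → 𝔭.asIdeal.inertiaDeg (𝓞 ℚ) = 1 →
      ∀ (𝔭' : HeightOneSpectrum (𝓞 K)), ((3 : ℕ) : 𝓞 K) ∈ 𝔭'.asIdeal → 𝔭' ≠ 𝔭 →
      Module.IsTorsion (IwasawaAlgebra 3) (XAc (W'.baseChange K) 3 κ 𝔭' ∅ γ) ∧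
        ∃ g' : UnrSeries 3,
          (XAc.charIdeal (W'.baseChange K) 3 κ 𝔭' ∅ γ).map (PowerSeries.map (Halves.toUnr 3)) =
              Ideal.span {g'} ∧
            ∃ i : ℕ, ‖((PowerSeries.coeff i g' : unrIntegers 3) : ℂ_[3])‖ = 1 :=
  Iff.rfl

end Summit.BirchSwinnertonDyer.BirchSwinnertonDyer.Theorems.UniversalToricDescentBetaRoadParamDefs

end
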